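import Literature.Analysis.FluidPDE.NSFourierPicard
import HarnessLib

/-!
# The forced Fourier–Duhamel map of the Navier–Stokes system: definitions

First file of the FORCED twin of the weighted-`L²` Fourier-side construction of the local smooth
solution of the Navier–Stokes system with `H¹`-controlled lifespan (the chain
`FourierL2Convolution → … → FourierL2PicardLimit → TaoH1FourierMildExists`, which discharges the
homogeneous case of T. Tao, *Localisation and compactness properties of the Navier–Stokes global
regularity problem*, Anal. PDE 6 (2013) 25–107 = arXiv:1108.1165, Thm. 5.4 (ii) = arXiv Thm. 31
(ii), p. 18). Tao's theorem is stated and proved WITH a forcing term `f`: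

  "If `(‖u₀‖_{H¹_x(ℝ³)} + ‖f‖_{L¹_t H¹_x(ℝ³)})⁴ T ≤ c` for a sufficiently small absolute constant
  `c > 0`, then there exists a `H¹` mild solution `(u, p, u₀, f, T)` with the indicated data"

(proof, p. 18: "by repeating the proof of Theorem 28 verbatim" — the contraction of the Duhamel
map `u ↦ e^{tΔ}u₀ + ∫₀ᵗ e^{(t-t')Δ}(P f − P∇·(u ⊗ u))(t') dt'` in `X¹ = L^∞_t H¹_x ∩ L²_t H²_x`,
p. 16, via the energy estimate (energy-duh2) and the bilinear estimate (bilinear-2) of Lemma 2.1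
= arXiv Lemma 23, p. 10). The tree needs the forced case for the named facts
`tao2011_smooth_local_existence_forced` (`TaoH1LocalExistenceForced.lean`) and
`tao2011_forced_H1_local_almost_regular` (`TaoH1AlmostRegularForced.lean`).

On the Fourier side (`v(t) = û(t)`, heat rate `c = 4π²ν`, projected force coefficients
`b(s, ξ) = (P f̂)(s, ξ)`) the Duhamel map acquires the **forcing term**

  `F(t, ξ) = ∫₀^τ e^{-c‖ξ‖²(τ-s)} b(s, ξ) ds`,  `τ = clamp T t`,

which does NOT depend on the unknown: differences of the forced map are differences of the
homogeneous map `FourierNS.duhamel`, so the contraction estimates of the homogeneous chain apply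
verbatim (this is also the pattern of the tree's `LinearisedNSFourierForcedDefs` on the torus).
This file only NAMES the objects; all properties are proved in the sequel files
(`ForcedFourierDuhamelForcing`, `ForcedFourierPicard*`):

* `FourierNS.forcing c T b` — the forcing term `F`;
* `FourierNS.duhamelForced c T a b v = duhamel c T a v + forcing c T b` — the forced clamped
  Duhamel (Picard) map;
* `FourierNS.picardIterForced c T a b n` — the forced Picard iterates
  `w₀ = e^{-c‖ξ‖²τ} a + F`, `w_{n+1} = Φ_b(w_n)`; `FourierNS.picardLimitForced` — their pointwise
  limit;
* `FourierNS.IsSobolevMildForced c T a b v` — Fourier-side `H¹`-mild solutions of Sobolev class of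
  the FORCED system (the forced twin of `FourierNS.IsSobolevMild` of `TaoH1FourierMild.lean`): the
  fixed-point identity for `duhamelForced`, with the same measurability, continuity, decay,
  divergence-free and conjugation-symmetry clauses.

Nothing is asserted here (definitions and their unfolding lemmas only).

## Mathlib / tree search

Tree (`lean search`): `FourierNS.duhamel`, `FourierNS.duhamelIntegral`, `FourierNS.picardIter`,
`FourierNS.picardLimit`, `FourierNS.heat`, `FourierNS.clamp` (`NSFourierPicard`);
`FourierNS.IsSobolevMild` (`TaoH1FourierMild`); the torus analogue `LinearisedNSFourier.forcing`,
`picardMapF` (`LinearisedNSFourierForcedDefs`). No forced Duhamel map for the Navier–Stokes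
system on `ℝ³` existed (`lean search 'duhamelForced|picardIterForced|IsSobolevMildForced'`: no
hits). Mathlib has no notion of mild Navier–Stokes solutions.

## References

* T. Tao, Anal. PDE 6 (2013) 25–107 = arXiv:1108.1165: (7) p. 3 (Duhamel formula with force),
  `H¹` mild solutions p. 6, Thm. 5.4 = arXiv Thm. 31 (p. 18) and the proof of Thm. 5.1 = arXiv
  Thm. 28 (p. 16). [Tao2011]
* J. Leray, Acta Math. 63 (1934), §19 (successive approximations). [Leray1934]
-/

noncomputable section

open MeasureTheory Set Function Filter Real Complex
open scoped ENNReal NNReal ComplexConjugate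
open _root_.Topology

namespace Literature.Analysis.FluidPDE.FourierNS

variable {ι : Type*} [Fintype ι] [DecidableEq ι]

/-! ### The forcing term -/

/-- **The forcing term of the Fourier–Duhamel formula.** For a heat rate `c`, a time `T` and
(projected) force coefficients `b : ℝ → E → ℂ^ι` (`E = EuclideanSpace ℝ ι`),
`forcing c T b t ξ = ∫₀^τ e^{-c‖ξ‖²(τ-s)} b(s, ξ) ds` with `τ = clamp T t` — the Fourier transform
of Tao's `∫₀ᵗ e^{(t-t')Δ} P f(t') dt'` (arXiv:1108.1165, (7), p. 3), time clamped to `[0, T]` as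
in `FourierNS.duhamel`. [cite: Tao2011, Thm. 5.4 (ii) (arXiv Thm. 31) and (7)] -/
def forcing (c T : ℝ) (b : ℝ → EuclideanSpace ℝ ι → ι → ℂ) (t : ℝ) (ξ : EuclideanSpace ℝ ι) :
    ι → ℂ :=
  ∫ s in (0 : ℝ)..clamp T t, heat c ξ (clamp T t - s) • b s ξ

omit [DecidableEq ι] in
/-- Unfolding `forcing`. [cite: Tao2011, Thm. 5.4 (ii) (arXiv Thm. 31), Duhamel formula (7)] -/
theorem forcing_eq (c T : ℝ) (b : ℝ → EuclideanSpace ℝ ι → ι → ℂ) (t : ℝ)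
    (ξ : EuclideanSpace ℝ ι) :
    forcing c T b t ξ = ∫ s in (0 : ℝ)..clamp T t, heat c ξ (clamp T t - s) • b s ξ := rfl

omit [DecidableEq ι] in
/-- The forcing term only sees clamped time. [cite: Tao2011, Thm. 5.4 (ii) (arXiv Thm. 31), Duhamel formula (7)] -/
theorem forcing_clamp {c T : ℝ} (hT : 0 ≤ T) (b : ℝ → EuclideanSpace ℝ ι → ι → ℂ) (t : ℝ)
    (ξ : EuclideanSpace ℝ ι) : forcing c T b (clamp T t) ξ = forcing c T b t ξ := by
  simp only [forcing, clamp_clamp hT]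

omit [DecidableEq ι] in
/-- The forcing term vanishes at `t = 0`. [cite: Tao2011, Thm. 5.4 (ii) (arXiv Thm. 31), Duhamel formula (7)] -/
theorem forcing_zero {c T : ℝ} (hT : 0 ≤ T) (b : ℝ → EuclideanSpace ℝ ι → ι → ℂ)
    (ξ : EuclideanSpace ℝ ι) : forcing c T b 0 ξ = 0 := by
  simp [forcing, clamp_zero hT]

/-! ### The forced Duhamel map, the forced Picard iterates and their limit -/

/-- **The forced clamped Duhamel (Picard) map** of the transformed Navier–Stokes system with
force coefficients `b`:
`Φ_b(v)(t, ξ) = e^{-c‖ξ‖²τ} a(ξ) − ∫₀^τ e^{-c‖ξ‖²(τ-s)} N(v(s), v(s))(ξ) ds + ∫₀^τ e^{-c‖ξ‖²(τ-s)} b(s, ξ) ds`,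
`τ = clamp T t`, i.e. `duhamel c T a v + forcing c T b` (Tao 2013, (7) and the proof of
Thm. 5.1/5.4: the Duhamel formula WITH force). [cite: Tao2011, Thm. 5.4 (ii) (arXiv Thm. 31)] -/
def duhamelForced (c T : ℝ) (a : EuclideanSpace ℝ ι → ι → ℂ) (b : ℝ → EuclideanSpace ℝ ι → ι → ℂ)
    (v : ℝ → EuclideanSpace ℝ ι → ι → ℂ) (t : ℝ) (ξ : EuclideanSpace ℝ ι) : ι → ℂ :=
  duhamel c T a v t ξ + forcing c T b t ξ

/-- Unfolding `duhamelForced`. [cite: Tao2011, Thm. 5.4 (ii) (arXiv Thm. 31), Duhamel formula (7)] -/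
theorem duhamelForced_eq (c T : ℝ) (a : EuclideanSpace ℝ ι → ι → ℂ)
    (b : ℝ → EuclideanSpace ℝ ι → ι → ℂ) (v : ℝ → EuclideanSpace ℝ ι → ι → ℂ) (t : ℝ)
    (ξ : EuclideanSpace ℝ ι) :
    duhamelForced c T a b v t ξ = duhamel c T a v t ξ + forcing c T b t ξ := rfl

/-- `Φ_b(v) = heat • a + forcing − duhamelIntegral`: the forced map in "free part minus Duhamel
part" form. [cite: Tao2011, Thm. 5.4 (ii) (arXiv Thm. 31), Duhamel formula (7)] -/
theorem duhamelForced_eq_sub (c T : ℝ) (a : EuclideanSpace ℝ ι → ι → ℂ)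
    (b : ℝ → EuclideanSpace ℝ ι → ι → ℂ) (v : ℝ → EuclideanSpace ℝ ι → ι → ℂ) (t : ℝ)
    (ξ : EuclideanSpace ℝ ι) :
    duhamelForced c T a b v t ξ =
      heat c ξ (clamp T t) • a ξ + forcing c T b t ξ - duhamelIntegral c T v t ξ := by
  rw [duhamelForced_eq, duhamel_eq]
  abel

/-- Differences of the forced map are differences of the homogeneous map (the forcing term does
not depend on the unknown). [cite: Tao2011, Thm. 5.4 (ii) (arXiv Thm. 31), Duhamel formula (7)] -/
theorem duhamelForced_sub_duhamelForced (c T : ℝ) (a : EuclideanSpace ℝ ι → ι → ℂ)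
    (b : ℝ → EuclideanSpace ℝ ι → ι → ℂ) (v w : ℝ → EuclideanSpace ℝ ι → ι → ℂ) (t : ℝ)
    (ξ : EuclideanSpace ℝ ι) :
    duhamelForced c T a b v t ξ - duhamelForced c T a b w t ξ =
      duhamel c T a v t ξ - duhamel c T a w t ξ := by
  rw [duhamelForced_eq, duhamelForced_eq]
  abel

/-- The forced map only sees clamped time. [cite: Tao2011, Thm. 5.4 (ii) (arXiv Thm. 31), Duhamel formula (7)] -/
theorem duhamelForced_clamp {c T : ℝ} (hT : 0 ≤ T) {a : EuclideanSpace ℝ ι → ι → ℂ}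
    {b : ℝ → EuclideanSpace ℝ ι → ι → ℂ} {v : ℝ → EuclideanSpace ℝ ι → ι → ℂ} (t : ℝ)
    (ξ : EuclideanSpace ℝ ι) :
    duhamelForced c T a b v (clamp T t) ξ = duhamelForced c T a b v t ξ := by
  rw [duhamelForced_eq, duhamelForced_eq, duhamel_clamp hT, forcing_clamp hT]

/-- `Φ_b(v)(0) = a`. [cite: Tao2011, Thm. 5.4 (ii) (arXiv Thm. 31), Duhamel formula (7)] -/
theorem duhamelForced_zero {c T : ℝ} (hT : 0 ≤ T) {a : EuclideanSpace ℝ ι → ι → ℂ}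
    {b : ℝ → EuclideanSpace ℝ ι → ι → ℂ} {v : ℝ → EuclideanSpace ℝ ι → ι → ℂ}
    (ξ : EuclideanSpace ℝ ι) : duhamelForced c T a b v 0 ξ = a ξ := by
  rw [duhamelForced_eq, duhamel_zero hT, forcing_zero hT, add_zero]

/-- **The forced Picard iterates** `w₀(t) = e^{-c‖ξ‖²τ} a + F(t)`, `w_{n+1} = Φ_b(w_n)`
(successive approximations for the Duhamel formula with force; Leray 1934, §19; Tao 2013, proof
of Thm. 5.1/5.4). [cite: Tao2011, Thm. 5.4 (ii) (arXiv Thm. 31)] -/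
def picardIterForced (c T : ℝ) (a : EuclideanSpace ℝ ι → ι → ℂ)
    (b : ℝ → EuclideanSpace ℝ ι → ι → ℂ) : ℕ → ℝ → EuclideanSpace ℝ ι → ι → ℂ
  | 0 => fun t ξ => heat c ξ (clamp T t) • a ξ + forcing c T b t ξ
  | n + 1 => duhamelForced c T a b (picardIterForced c T a b n)

/-- `w₀ = heat • a + forcing`. [cite: Tao2011, Thm. 5.4 (ii) (arXiv Thm. 31), Duhamel formula (7)] -/
theorem picardIterForced_zero (c T : ℝ) (a : EuclideanSpace ℝ ι → ι → ℂ)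
    (b : ℝ → EuclideanSpace ℝ ι → ι → ℂ) :
    picardIterForced c T a b 0 = fun t ξ => heat c ξ (clamp T t) • a ξ + forcing c T b t ξ := rfl

/-- `w_{n+1} = Φ_b(w_n)`. [cite: Tao2011, Thm. 5.4 (ii) (arXiv Thm. 31), Duhamel formula (7)] -/
theorem picardIterForced_succ (c T : ℝ) (a : EuclideanSpace ℝ ι → ι → ℂ)
    (b : ℝ → EuclideanSpace ℝ ι → ι → ℂ) (n : ℕ) :
    picardIterForced c T a b (n + 1) = duhamelForced c T a b (picardIterForced c T a b n) := rfl

/-- The Duhamel-part form of the recursion: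
`heat • a + forcing − w_{n+1} = duhamelIntegral c T w_n`. [cite: Tao2011, Thm. 5.4 (ii) (arXiv Thm. 31), Duhamel formula (7)] -/
theorem free_sub_picardIterForced_succ (c T : ℝ) (a : EuclideanSpace ℝ ι → ι → ℂ)
    (b : ℝ → EuclideanSpace ℝ ι → ι → ℂ) (n : ℕ) (t : ℝ) (ξ : EuclideanSpace ℝ ι) :
    heat c ξ (clamp T t) • a ξ + forcing c T b t ξ - picardIterForced c T a b (n + 1) t ξ =
      duhamelIntegral c T (picardIterForced c T a b n) t ξ := by
  rw [picardIterForced_succ, duhamelForced_eq_sub]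
  abel

/-- **The limit of the forced Picard scheme** `w(t, ξ) = lim_n w_n(t, ξ)` (pointwise; a junk
value where the limit does not exist — under the smallness condition of the sequel files it does,
at every `(t, ξ)`). [cite: Tao2011, Thm. 5.4 (ii) (arXiv Thm. 31), Duhamel formula (7)] -/
def picardLimitForced (c T : ℝ) (a : EuclideanSpace ℝ ι → ι → ℂ)
    (b : ℝ → EuclideanSpace ℝ ι → ι → ℂ) (t : ℝ) (ξ : EuclideanSpace ℝ ι) : ι → ℂ :=
  limUnder atTop fun n => picardIterForced c T a b n t ξ

/-! ### Fourier-side `H¹`-mild solutions of Sobolev class of the forced system -/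

/-- **Fourier-side `H¹`-mild solutions of Sobolev class of the FORCED Navier–Stokes system.**
For a heat rate `c` (`= 4π²ν`), a time `T`, a Fourier datum `a : E → ℂ^ι` and projected force
coefficients `b : ℝ → E → ℂ^ι`, `v : ℝ → E → ℂ^ι` is a mild solution on `[0, T]` of
`∂ₜv = -c‖ξ‖² v − N(v, v) + b`, `v(0) = a`, in the sense of the tree's `IsSobolevMild`
(`TaoH1FourierMild.lean`) with the forcing term added to the fixed-point identity: measurable time
slices, continuity in time at every frequency, `v = duhamelForced c T a b v` (time clamped to
`[0, T]`), pointwise polynomial decay of every order of `v(t) − e^{-c‖ξ‖²τ} a` uniformly in time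
(this difference is the forcing term minus the Duhamel integral), the divergence-free symbol
relation and the conjugation symmetry. This is Tao's `H¹` mild solution `(u, p, u₀, f, T)`
(arXiv:1108.1165, p. 6: "`u` obeys the Duhamel formula (7)") written for `v(t) = û(t)`,
`b = (P f)^`. [cite: Tao2011, Thm. 5.4 (arXiv Thm. 31) and p. 6] -/
structure IsSobolevMildForced (c T : ℝ) (a : EuclideanSpace ℝ ι → ι → ℂ)
    (b : ℝ → EuclideanSpace ℝ ι → ι → ℂ) (v : ℝ → EuclideanSpace ℝ ι → ι → ℂ) : Prop where
  /-- measurable time slices -/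
  meas : ∀ t, AEStronglyMeasurable (v t) volume
  /-- continuity in time at every frequency -/
  cont : ∀ ξ, Continuous fun t => v t ξ
  /-- the fixed-point (forced Duhamel) identity, time clamped to `[0, T]` -/
  fixed : ∀ t ξ, v t ξ = duhamelForced c T a b v t ξ
  /-- pointwise polynomial decay of every order of `v − heat • a`, uniformly in time -/
  decay : ∀ K : ℕ, ∃ B : ℝ, ∀ t ξ, (1 + ‖ξ‖) ^ K * ‖v t ξ - heat c ξ (clamp T t) • a ξ‖ ≤ B
  /-- the divergence-free symbol relation `∑ₗ ξₗ vₗ(t, ξ) = 0` -/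
  divFree : ∀ t ξ, ∑ l, ((ξ l : ℝ) : ℂ) * v t ξ l = 0
  /-- conjugation symmetry (reality of the synthesized velocity) -/
  conjSymm : ∀ t ξ l, v t (-ξ) l = conj (v t ξ l)

/-- An `IsSobolevMildForced` solution starts at the datum: `v 0 = a` (for `T ≥ 0`). [cite: Tao2011, Thm. 5.4 (ii) (arXiv Thm. 31), Duhamel formula (7)] -/
theorem IsSobolevMildForced.apply_zero {c T : ℝ} {a : EuclideanSpace ℝ ι → ι → ℂ}
    {b : ℝ → EuclideanSpace ℝ ι → ι → ℂ} {v : ℝ → EuclideanSpace ℝ ι → ι → ℂ}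
    (h : IsSobolevMildForced c T a b v) (hT : 0 ≤ T) (ξ : EuclideanSpace ℝ ι) : v 0 ξ = a ξ := by
  rw [h.fixed 0 ξ, duhamelForced_zero hT]

/-- An `IsSobolevMildForced` solution only sees clamped time: `v (clamp T t) = v t`. [cite: Tao2011, Thm. 5.4 (ii) (arXiv Thm. 31), Duhamel formula (7)] -/
theorem IsSobolevMildForced.apply_clamp {c T : ℝ} {a : EuclideanSpace ℝ ι → ι → ℂ}
    {b : ℝ → EuclideanSpace ℝ ι → ι → ℂ} {v : ℝ → EuclideanSpace ℝ ι → ι → ℂ}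
    (h : IsSobolevMildForced c T a b v) (hT : 0 ≤ T) (t : ℝ) (ξ : EuclideanSpace ℝ ι) :
    v (clamp T t) ξ = v t ξ := by
  rw [h.fixed (clamp T t) ξ, h.fixed t ξ, duhamelForced_clamp hT]

end Literature.Analysis.FluidPDE.FourierNS

end
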